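import Summits.Ventures.WeilGRH.UniformConductorFloorLog12TableValidA
import Summits.Ventures.WeilGRH.UniformConductorFloorLog12TableValidB
import Summits.Ventures.WeilGRH.UniformConductorFloorLog12TableValidC
import Summits.Ventures.WeilGRH.UniformConductorFloorLog12TableValidD
import Summits.Ventures.WeilGRH.UniformConductorFloorLog12TableValidE
import Summits.Ventures.WeilGRH.UniformConductorFloorLog12TableValidF
import Summits.Ventures.WeilGRH.UniformConductorFloorLog12TableValidG
import HarnessLib

/-!
# GRH arm (rh-explicit, venture WeilGRH): the special-value table at `a = (log 12)/2` — `tab_valid : TabValid (2^80) a ks 128 tab` (glue of the seven kernel parts)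

Cell `rh-explicit`, WEIL TRACK — GRH ARM (weil-grh-1 gen10; glue of gen9's kernel parts A–G, re-cut so that B–G import only A and file in parallel).
`UniformConductorFloorLog12TableValidA.lean` certifies `P`, `A`, `C`, the prime data and the modes `0 … 19`; parts B … G certify the `checkTable` slices
`[20,40), …, [120,128)`; this file chains them with `TabValid.extend` into `tab_valid : TabValid (2^80) ((log 12)/2) ks 128 tab` — the input of weil-grh-2's
twisted cell kits (door E) and of the table-based Galerkin refutation at this window.  No kernel computation here; no definitions; standard axioms.
[cite: Moore1966, Ch. 3 (interval arithmetic: inclusion property)]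
-/

namespace Summit.Ventures.WeilGRH.Log12Table
open Literature.NumberTheory.LFunctions Literature.NumberTheory.LFunctions.Yoshida1992 Encl Literature.Analysis.ValidatedNumerics.NumericsMP

/-- The table is valid below `40`. [cite: Moore1966, Ch. 3 (interval arithmetic: inclusion property)] -/
theorem tab_valid40 : TabValid (2 ^ 80) a ks (20 + 20) tab :=
  tab_valid20.extend fun n hn hnk ↦ idxValid_of_checkTable (prm := prm) (by norm_num [prm]) a_pos consts_valid tT20 hn hnk

/-- The table is valid below `60`. [cite: Moore1966, Ch. 3 (interval arithmetic: inclusion property)] -/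
theorem tab_valid60 : TabValid (2 ^ 80) a ks (40 + 20) tab :=
  tab_valid40.extend fun n hn hnk ↦ idxValid_of_checkTable (prm := prm) (by norm_num [prm]) a_pos consts_valid tT40 hn hnk

/-- The table is valid below `80`. [cite: Moore1966, Ch. 3 (interval arithmetic: inclusion property)] -/
theorem tab_valid80 : TabValid (2 ^ 80) a ks (60 + 20) tab :=
  tab_valid60.extend fun n hn hnk ↦ idxValid_of_checkTable (prm := prm) (by norm_num [prm]) a_pos consts_valid tT60 hn hnk

/-- The table is valid below `100`. [cite: Moore1966, Ch. 3 (interval arithmetic: inclusion property)] -/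
theorem tab_valid100 : TabValid (2 ^ 80) a ks (80 + 20) tab :=
  tab_valid80.extend fun n hn hnk ↦ idxValid_of_checkTable (prm := prm) (by norm_num [prm]) a_pos consts_valid tT80 hn hnk

/-- The table is valid below `120`. [cite: Moore1966, Ch. 3 (interval arithmetic: inclusion property)] -/
theorem tab_valid120 : TabValid (2 ^ 80) a ks (100 + 20) tab :=
  tab_valid100.extend fun n hn hnk ↦ idxValid_of_checkTable (prm := prm) (by norm_num [prm]) a_pos consts_valid tT100 hn hnk

/-- The table is valid below `128`. [cite: Moore1966, Ch. 3 (interval arithmetic: inclusion property)] -/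
theorem tab_valid128 : TabValid (2 ^ 80) a ks (120 + 8) tab :=
  tab_valid120.extend fun n hn hnk ↦ idxValid_of_checkTable (prm := prm) (by norm_num [prm]) a_pos consts_valid tT120 hn hnk

/-- ★ The `(log 12)/2` special-value table is valid below `128`. [cite: Moore1966, Ch. 3 (interval arithmetic: inclusion property)] -/
theorem tab_valid : TabValid (2 ^ 80) a ks 128 tab := tab_valid128

end Summit.Ventures.WeilGRH.Log12Table
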